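import Summits.QuantumFields.YangMills.Theorems.BalabanUVNodesN07TraceSectorDefs
import Summits.QuantumFields.YangMills.Theorems.BalabanUVNodesN07RecordLettersTraceSectors
import HarnessLib

/-!
# NODE N07 — THE FIBREWISE SCALAR PART `scalPartW` IS THE ORTHOGONAL PROJECTION ONTO THE SCALAR SECTOR; «RESPECTS THE TRACE SECTORS» ⟺ «COMMUTES WITH `scalPartW`»; THE GAUGE
# PROJECTION `R(U₀; Q′♭) = RrOfRecord` OF def-Y's SCHEME COMMUTES WITH IT AT EVERY `N ≥ 1`, and so do `D_{U₀}`, `D*_{U₀}`, `Δ_{U₀}` (every `N`) and `Δ(U₀) = hessOpOfRecord` (`N = 2`)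
# ([B9] (3.21)–(3.23) p. 394; [15] (51) p. 286)

Cell `pub-ymgap`, width seat `pub-ymgap-dag-n07-w3` (g26), CLAIM-18.  `--kind proof --supports stmt-QuantumFields-27238 --as helper`; count-neutral.
[15] = [Balaban1985Variational]; [B9] = [Balaban1985BackgroundPropagators].

CONTENTS (`S := scalPartW N w` of ✓`…N07TraceSectorDefs`, `φ = phiRec N`).
* §1 `trace_phiRec_equiv_scalPartW` (`tr φ(Sf)(i) = tr φ f(i)`), `scalPartW_scalPartW` (idempotent), `scalPartW_eq_zero_iff` (`Sf = 0` ⟺ traceless-valued), `scalPartW_eq_self_iff` (`Sf = f` ⟺ scalar-valued),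
  `scalPartW_isSymmetric` (symmetric for the weighted `L²` product: `⟪φ⁻¹X, φ⁻¹Y⟫ = tr X*Y`).
* §2 ★`comp_scalPartW_eq_iff` — for a linear `L` between two record carriers: `S ∘ L = L ∘ S` ⟺ (`L` maps traceless-valued to traceless-valued AND scalar-valued to scalar-valued).
* §3 (generic Hilbert space) ★`starProjection_map_of_isSymmetric` — a SYMMETRIC `S` leaving a finite-dimensional subspace `K` invariant commutes with the orthogonal projection onto `K`.
* §4 (record) `scalPartW_comp_covDerivL2K_ofRecord`, `…covDivL2K…`, `…covLaplaceSiteK…` (every `N ≥ 1`), `scalPartW_comp_hessOpOfRecord_two` (`N = 2`),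
  ★★`scalPartW_comp_RrOfRecord` — `R(U₀; Q′♭) ∘ S = S ∘ R(U₀; Q′♭)` at every `N ≥ 1` and every background (the range `Δ_{U₀}N(Q′♭)` is `S`-invariant).

HONEST LABELS.  Finite-dimensional linear algebra; no estimate; `Q(U₀)`, `G₁`, `K⁻¹`, `H₁`, `H♭`, `𝔊`, `π`, `C^{𝔰𝔩}`, `W` still owe their trace letters (the inverses follow algebraically from their
two-sided inverse identities once `Q(U₀)` is done).  Count-neutral; N07 NOT discharged; P0 ⟨26900⟩ OPEN; R4 is the conditional finite-𝕋⁴ rung only.  Nothing here is a claim about the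
Yang–Mills mass gap (`Summit.QuantumFields`): finite torus, fixed `ε`; nothing continuum ∕ OS ∕ Clay.
-/

set_option autoImplicit false

noncomputable section

open scoped Matrix Matrix.Norms.L2Operator InnerProductSpace ComplexConjugate BigOperators

namespace Summit.QuantumFields.YangMills.Theorems.N07TraceSectorProjection

open Literature.MathematicalPhysics.QuantumFieldTheory.Balaban1983to89
open Literature.MathematicalPhysics.QuantumFieldTheory.Balaban1983to89.T4Continuum (T4Family)
open T4Continuum BlockAveraging
open Node00
open B4Sect5Torus (TSite)
open B9SectCLatticeCarrier (Bond)
open B9Eq311L2Pairing (WL2)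
open B11Eq103H1Complex (SiteL2K BondL2K covDerivL2K covDivL2K covLaplaceSiteK projR RLatticeK)
open Summit.QuantumFields.YangMills.Theorems.N07TraceSectorDefs (scalPartW equiv_scalPartW phiRec_equiv_scalPartW)
open Summit.QuantumFields.YangMills.Theorems.N07HessOpTraceSU2 (hessOpOfRecord_traceless hessOpOfRecord_scalar)
open Summit.QuantumFields.YangMills.Theorems.N07RecordLettersTraceSectors (covDerivL2K_ofRecord_traceless covDerivL2K_ofRecord_scalar covDivL2K_ofRecord_traceless
  covDivL2K_ofRecord_scalar covLaplaceSiteK_ofRecord_traceless covLaplaceSiteK_ofRecord_scalar QflatOfRecord_traceless)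

/-! ## §1  `scalPartW` is a symmetric idempotent whose kernel ∕ fixed space are the traceless ∕ scalar sectors -/

section Generic

variable (N : ℕ) {ι : Type*} (w : ι → ℝ)

/-- `tr φ(Sf)(i) = tr φ f(i)` (`N ≥ 1`). [cite: Balaban1985Variational, (51) p.286 (bookkeeping)] -/
theorem trace_phiRec_equiv_scalPartW [NeZero N] (f : WL2 ℂ w (WRec N)) (i : ι) :
    (phiRec N (WL2.equiv ℂ w (WRec N) (scalPartW N w f) i)).trace = (phiRec N (WL2.equiv ℂ w (WRec N) f i)).trace := by
  rw [phiRec_equiv_scalPartW, Matrix.trace_smul, Matrix.trace_one, Fintype.card_fin, smul_eq_mul, mul_comm ((N : ℂ))⁻¹, mul_assoc,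
    inv_mul_cancel₀ (Nat.cast_ne_zero.2 (NeZero.ne N)), mul_one]

/-- **`S` IS IDEMPOTENT.** [cite: Balaban1985Variational, (51) p.286 (bookkeeping)] -/
theorem scalPartW_scalPartW [NeZero N] (f : WL2 ℂ w (WRec N)) : scalPartW N w (scalPartW N w f) = scalPartW N w f := by
  apply (WL2.equiv ℂ w (WRec N)).injective
  funext i
  rw [equiv_scalPartW N w (scalPartW N w f) i, trace_phiRec_equiv_scalPartW, equiv_scalPartW]

/-- **`Sf = 0` ⟺ `f` IS TRACELESS-VALUED** (`N ≥ 1`). [cite: Balaban1985Variational, (51) p.286] -/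
theorem scalPartW_eq_zero_iff [NeZero N] (f : WL2 ℂ w (WRec N)) :
    scalPartW N w f = 0 ↔ ∀ i, (phiRec N (WL2.equiv ℂ w (WRec N) f i)).trace = 0 := by
  have hN : ((N : ℂ))⁻¹ ≠ 0 := inv_ne_zero (Nat.cast_ne_zero.2 (NeZero.ne N))
  constructor
  · intro h i
    have hi := congrArg (fun g => phiRec N (WL2.equiv ℂ w (WRec N) g i)) h
    simp only [phiRec_equiv_scalPartW, WL2.equiv_zero, Pi.zero_apply, map_zero] at hi
    have h1 : (((N : ℂ))⁻¹ * (phiRec N (WL2.equiv ℂ w (WRec N) f i)).trace) = 0 := by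
      by_contra hne
      exact one_ne_zero ((smul_eq_zero.1 hi).resolve_left hne)
    exact (mul_eq_zero.1 h1).resolve_left hN
  · intro h
    apply (WL2.equiv ℂ w (WRec N)).injective
    funext i
    rw [equiv_scalPartW, h i, mul_zero, zero_smul, map_zero, WL2.equiv_zero, Pi.zero_apply]

/-- **`Sf = f` ⟺ `f` IS SCALAR-VALUED** (`N ≥ 1`). [cite: Balaban1985BackgroundPropagators, p.391] -/
theorem scalPartW_eq_self_iff [NeZero N] (f : WL2 ℂ w (WRec N)) :
    scalPartW N w f = f ↔ ∀ i, ∃ r : ℂ, phiRec N (WL2.equiv ℂ w (WRec N) f i) = r • (1 : Matrix (Fin N) (Fin N) ℂ) := by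
  constructor
  · intro h i
    exact ⟨((N : ℂ))⁻¹ * (phiRec N (WL2.equiv ℂ w (WRec N) f i)).trace, by rw [← phiRec_equiv_scalPartW, h]⟩
  · intro h
    apply (WL2.equiv ℂ w (WRec N)).injective
    funext i
    obtain ⟨r, hr⟩ := h i
    have hf : WL2.equiv ℂ w (WRec N) f i = (phiRec N).symm (r • (1 : Matrix (Fin N) (Fin N) ℂ)) := by rw [← hr, LinearEquiv.symm_apply_apply]
    rw [equiv_scalPartW, hr, Matrix.trace_smul, Matrix.trace_one, Fintype.card_fin, smul_eq_mul, ← mul_assoc, mul_comm ((N : ℂ))⁻¹, mul_assoc,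
      inv_mul_cancel₀ (Nat.cast_ne_zero.2 (NeZero.ne N)), mul_one, hf]

/-- The scalar part is scalar-valued. [cite: Balaban1985BackgroundPropagators, p.391 (bookkeeping)] -/
theorem scalPartW_scalar (f : WL2 ℂ w (WRec N)) (i : ι) :
    ∃ r : ℂ, phiRec N (WL2.equiv ℂ w (WRec N) (scalPartW N w f) i) = r • (1 : Matrix (Fin N) (Fin N) ℂ) :=
  ⟨_, phiRec_equiv_scalPartW N w f i⟩

variable [Fintype ι] [Fact (∀ i, 0 < w i)]

/-- **`S` IS SYMMETRIC for the weighted `L²` product of record** (`⟪φ⁻¹X, φ⁻¹Y⟫ = tr X*Y`: `tr(((c·1))* Y) = conj c · tr Y`). [cite: Balaban1985BackgroundPropagators, (3.11) p.392] -/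
theorem scalPartW_isSymmetric : (scalPartW N w).IsSymmetric := by
  intro f g
  rw [WL2.inner_def, WL2.inner_def]
  refine Finset.sum_congr rfl fun i _ => ?_
  congr 1
  have hf : WL2.equiv ℂ w (WRec N) f i = (phiRec N).symm (phiRec N (WL2.equiv ℂ w (WRec N) f i)) := ((phiRec N).symm_apply_apply _).symm
  have hg : WL2.equiv ℂ w (WRec N) g i = (phiRec N).symm (phiRec N (WL2.equiv ℂ w (WRec N) g i)) := ((phiRec N).symm_apply_apply _).symm
  rw [equiv_scalPartW, equiv_scalPartW, hg, inner_phiRec_symm, LinearEquiv.apply_symm_apply, hf, inner_phiRec_symm, LinearEquiv.apply_symm_apply,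
    Matrix.traceLinearMap_apply, Matrix.traceLinearMap_apply, star_smul, star_one, Matrix.smul_mul, Matrix.one_mul, Matrix.trace_smul, Matrix.mul_smul,
    Matrix.mul_one, Matrix.trace_smul, Matrix.star_eq_conjTranspose, Matrix.trace_conjTranspose, smul_eq_mul, smul_eq_mul, Complex.star_def, map_mul,
    map_inv₀, map_natCast]
  ring

end Generic

/-! ## §2  «Respects the trace sectors» ⟺ «commutes with `S`» -/

section Comm

variable (N : ℕ) [NeZero N] {ι : Type*} (w : ι → ℝ) {ι' : Type*} (w' : ι' → ℝ)

/-- ★ **A LINEAR LETTER COMMUTES WITH THE SCALAR PART IFF IT MAPS TRACELESS-VALUED TO TRACELESS-VALUED AND SCALAR-VALUED TO SCALAR-VALUED** (`f = (f − Sf) + Sf`).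
[cite: Balaban1985Variational, (51) p.286; Balaban1985BackgroundPropagators, p.391] -/
theorem comp_scalPartW_eq_iff (L : WL2 ℂ w (WRec N) →ₗ[ℂ] WL2 ℂ w' (WRec N)) :
    scalPartW N w' ∘ₗ L = L ∘ₗ scalPartW N w ↔
      (∀ f : WL2 ℂ w (WRec N), (∀ i, (phiRec N (WL2.equiv ℂ w (WRec N) f i)).trace = 0) → ∀ j, (phiRec N (WL2.equiv ℂ w' (WRec N) (L f) j)).trace = 0) ∧
      (∀ f : WL2 ℂ w (WRec N), (∀ i, ∃ r : ℂ, phiRec N (WL2.equiv ℂ w (WRec N) f i) = r • (1 : Matrix (Fin N) (Fin N) ℂ)) →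
        ∀ j, ∃ r : ℂ, phiRec N (WL2.equiv ℂ w' (WRec N) (L f) j) = r • (1 : Matrix (Fin N) (Fin N) ℂ)) := by
  constructor
  · intro h
    refine ⟨fun f hf => ?_, fun f hf => ?_⟩
    · have h0 : scalPartW N w f = 0 := (scalPartW_eq_zero_iff N w f).2 hf
      have h1 : scalPartW N w' (L f) = 0 := by rw [← LinearMap.comp_apply, h, LinearMap.comp_apply, h0, map_zero]
      exact (scalPartW_eq_zero_iff N w' (L f)).1 h1
    · have h0 : scalPartW N w f = f := (scalPartW_eq_self_iff N w f).2 hf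
      have h1 : scalPartW N w' (L f) = L f := by rw [← LinearMap.comp_apply, h, LinearMap.comp_apply, h0]
      exact (scalPartW_eq_self_iff N w' (L f)).1 h1
  · rintro ⟨htr, hsc⟩
    apply LinearMap.ext
    intro f
    have hs : scalPartW N w' (L (scalPartW N w f)) = L (scalPartW N w f) := (scalPartW_eq_self_iff N w' _).2 (hsc _ (scalPartW_scalar N w f))
    have ht : scalPartW N w' (L (f - scalPartW N w f)) = 0 :=
      (scalPartW_eq_zero_iff N w' _).2 (htr _ ((scalPartW_eq_zero_iff N w _).1 (by rw [map_sub, scalPartW_scalPartW, sub_self])))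
    rw [LinearMap.comp_apply, LinearMap.comp_apply]
    calc scalPartW N w' (L f) = scalPartW N w' (L (f - scalPartW N w f)) + scalPartW N w' (L (scalPartW N w f)) := by
          rw [← map_add, ← map_add, sub_add_cancel]
      _ = L (scalPartW N w f) := by rw [ht, hs, zero_add]

end Comm

/-! ## §3  A symmetric operator leaving a subspace invariant commutes with the orthogonal projection onto it -/

section Hilbert

variable {E : Type*} [NormedAddCommGroup E] [InnerProductSpace ℂ E] [FiniteDimensional ℂ E]

/-- ★ **A SYMMETRIC `S` WITH `S K ⊆ K` COMMUTES WITH THE ORTHOGONAL PROJECTION ONTO `K`** (uniqueness of the projection: `S(Pf) ∈ K` and `Sf − S(Pf) = S(f − Pf) ⊥ K` since `S K ⊆ K`).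
[folklore] [cite: Balaban1985BackgroundPropagators, (3.21) p.394 (where it is used: `R(U)` is an orthogonal projection)] -/
theorem starProjection_map_of_isSymmetric (K : Submodule ℂ E) {S : E →ₗ[ℂ] E} (hS : S.IsSymmetric) (hK : ∀ f ∈ K, S f ∈ K) (f : E) :
    haveI : CompleteSpace K := FiniteDimensional.complete ℂ _
    K.starProjection (S f) = S (K.starProjection f) := by
  haveI : CompleteSpace K := FiniteDimensional.complete ℂ _
  apply Submodule.eq_starProjection_of_mem_of_inner_eq_zero (hK _ (K.starProjection_apply_mem f))
  intro g hg
  rw [← map_sub, hS, Submodule.starProjection_inner_eq_zero f _ (hK g hg)]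

end Hilbert

/-! ## §4  At the record: `D`, `D*`, `Δ_{U₀}`, `Δ(U₀)` (`N = 2`) and `R(U₀; Q′♭)` commute with the scalar part -/

section Record

variable (F : T4Family) (N : ℕ) [NeZero N] (K : ℕ) (k : ℕ) (U₀ : GaugeField (F.P K) 0 (SU N)) [Fact (0 < c0Rec F K k)]

/-- **`S ∘ D_{U₀} = D_{U₀} ∘ S`** at the record, every `N ≥ 1`. [cite: Balaban1985BackgroundPropagators, (3.3) p.391; Balaban1985Variational, (51) p.286] -/
theorem scalPartW_comp_covDerivL2K_ofRecord :
    scalPartW N _ ∘ₗ covDerivL2K ℂ (c0Rec F K k) (cRec F K k) (RRec F N U₀) = covDerivL2K ℂ (c0Rec F K k) (cRec F K k) (RRec F N U₀) ∘ₗ scalPartW N _ :=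
  (comp_scalPartW_eq_iff N _ _ _).2 ⟨fun _ hf => covDerivL2K_ofRecord_traceless F N K k U₀ hf, fun _ hf => covDerivL2K_ofRecord_scalar F N K k U₀ hf⟩

/-- **`S ∘ D*_{U₀} = D*_{U₀} ∘ S`** at the record, every `N ≥ 1`. [cite: Balaban1985BackgroundPropagators, (3.8) p.392] -/
theorem scalPartW_comp_covDivL2K_ofRecord :
    scalPartW N _ ∘ₗ covDivL2K ℂ (c0Rec F K k) (cRec F K k) (SRec F N U₀) = covDivL2K ℂ (c0Rec F K k) (cRec F K k) (SRec F N U₀) ∘ₗ scalPartW N _ :=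
  (comp_scalPartW_eq_iff N _ _ _).2 ⟨fun _ hA => covDivL2K_ofRecord_traceless F N K k U₀ hA, fun _ hA => covDivL2K_ofRecord_scalar F N K k U₀ hA⟩

/-- **`S ∘ Δ_{U₀} = Δ_{U₀} ∘ S`** on the site fields of record, every `N ≥ 1`. [cite: Balaban1985BackgroundPropagators, (3.23) p.394] -/
theorem scalPartW_comp_covLaplaceSiteK_ofRecord :
    scalPartW N _ ∘ₗ covLaplaceSiteK (cRec F K k) (RRec F N U₀) (SRec F N U₀) =
      covLaplaceSiteK (c₀ := c0Rec F K k) (cRec F K k) (RRec F N U₀) (SRec F N U₀) ∘ₗ scalPartW N _ :=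
  (comp_scalPartW_eq_iff N _ _ _).2 ⟨fun _ hf => covLaplaceSiteK_ofRecord_traceless F N K k U₀ hf, fun _ hf => covLaplaceSiteK_ofRecord_scalar F N K k U₀ hf⟩

/-- ★★ **THE GAUGE PROJECTION `R(U₀; Q′♭)` OF def-Y's SCHEME COMMUTES WITH THE SCALAR PART AT EVERY `N ≥ 1` AND EVERY BACKGROUND**: its range `Δ_{U₀}N(Q′♭)` is `S`-invariant
(`Δ_{U₀}` commutes with `S`; `N(Q′♭)` is `S`-invariant since `Q′♭` reads values) and `R` is the orthogonal projection onto it (§3, `S` symmetric).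
[cite: Balaban1985BackgroundPropagators, (3.21)–(3.23) p.394; Balaban1985Variational, (51) p.286] -/
theorem scalPartW_comp_RrOfRecord :
    scalPartW N _ ∘ₗ RrOfRecord F N k U₀ (QflatOfRecord F N k) = RrOfRecord F N k U₀ (QflatOfRecord F N k) ∘ₗ scalPartW N _ := by
  apply LinearMap.ext
  intro f
  rw [LinearMap.comp_apply, LinearMap.comp_apply]
  unfold RrOfRecord RLatticeK projR
  simp only [ContinuousLinearMap.coe_coe]
  symm
  refine starProjection_map_of_isSymmetric _ (scalPartW_isSymmetric N _) (fun g hg => ?_) f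
  obtain ⟨q, hq, rfl⟩ := Submodule.mem_map.1 hg
  rw [LinearMap.mem_ker] at hq
  refine Submodule.mem_map.2 ⟨scalPartW N _ q, ?_, ?_⟩
  · rw [LinearMap.mem_ker]
    funext y
    rw [QflatOfRecord_apply, siteFieldIn_apply, phiRec_equiv_scalPartW, Pi.zero_apply]
    have h0 := congrFun hq y
    rw [QflatOfRecord_apply, siteFieldIn_apply, Pi.zero_apply] at h0
    rw [h0, Matrix.trace_zero, mul_zero, zero_smul]
  · rw [← LinearMap.comp_apply, ← scalPartW_comp_covLaplaceSiteK_ofRecord, LinearMap.comp_apply]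

end Record

section SU2

variable (F : T4Family) (K : ℕ) (k : ℕ) (U₀ : GaugeField (F.P K) 0 (SU 2)) [Fact (0 < c0Rec F K k)]

/-- ★ **`S ∘ Δ(U₀) = Δ(U₀) ∘ S` FOR def-Y's HESSIAN LETTER AT `N = 2`** (✓`…N07HessOpTraceSU2`). [cite: Balaban1985BackgroundPropagators, (3.10) p.392; Balaban1985Variational, (51) p.286] -/
theorem scalPartW_comp_hessOpOfRecord_two :
    scalPartW 2 _ ∘ₗ hessOpOfRecord F 2 k U₀ = hessOpOfRecord F 2 k U₀ ∘ₗ scalPartW 2 _ :=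
  (comp_scalPartW_eq_iff 2 _ _ _).2 ⟨fun _ hg => hessOpOfRecord_traceless F K k U₀ hg, fun _ hg => hessOpOfRecord_scalar F K k U₀ hg⟩

end SU2

end Summit.QuantumFields.YangMills.Theorems.N07TraceSectorProjection

end
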